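import Summits.BirchSwinnertonDyer.Rank1Residual.Additive.GordEvenCongruentPartnerBSD
import Literature.NumberTheory.EllipticCurves.Fisher2012.HesseFamilyFiveClosedForms
import Literature.NumberTheory.EllipticCurves.Fisher2012.HesseFamilyFiveIndClosedForms
import HarnessLib

/-!
# The e346 END-of-ENDs `T-E346-TP` at `p = 5`, sequel: the congruence link I1 as a KERNEL IDENTITY —
# `TorsionIso W₁ W 5` from a rational point on Fisher's genus-`0` family `X_E(5)` (direct) or
# `X_E^{(2)}(5)` (indirect) over the partner, and the §A′/§B′ ENDs of `GordEvenCongruentPartnerBSD`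
# with the link binder `hT` so replaced
# (cell `b2b-bsdres`, team n1011, seat p07 (gen 9) — row T-E346-TP §D′; spec r2 ROUTE-2 §II.30.3 /
# II.30.8; sibling file because the lint caps Theorems-side files at 400 lines)

HONEST FRAMING (cell `b2b-bsdres`, run/shared/lean/b2b/bsd-rank1-residual/, verbatim in every
file): the goal of the cell is to DELETE the COMBINATION-SHAPED residual classes of the
Birch–Swinnerton-Dyer formula for ALL analytic-rank `≤ 1` elliptic curves over `ℚ` — "full BSD
formula for every rank `≤ 1` curve in class `C`" assembled STRICTLY from published theorems — so
that the rank-`≤ 1` remainder becomes exactly the CONSTRUCTION-SHAPED classes, which are TYPED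
(missing-input `Prop`s), NOT attempted. This is not "finishing BSD". Team n1011 (N10/N11, the
X4♯(G-ord) rows of defect `e = 4` at `p = 5` on the line-even locus — the (5;4,4) links): research
route; labels and marks UNCHANGED; nothing booked; census / instrument output = EVIDENCE, never a
Literature fact. ASSEMBLY theorems only: NO definition, NO named fact, NO new named-fact debt — the
two Fisher facts are ALREADY registered in the tree (`Literature/…/Fisher2012/HesseFamilyFiveCongruence.lean`:
`thm132_fiveCongruent_hessePencil`, Proc. LMS 104 (2012) Thm. 13.2 (n = 5), and
`thm58_fiveCongruent_hessePencilInd`, Math. Ann. 356 (2013) Thm. 5.8; PUB) and enter as the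
HYPOTHESES `hF` / `hF'`, exactly as in cc-eng-2's proved certificate corollaries
`Fisher2012.fiveCongruent_of_hesseCertificate` / `…IndCertificate` and the O5 precedent
`O5/X3ECertificates`; every other printed input is a binder of the consumed ENDs (`hDelA` STANDING,
flag `Del02-ThmB-ellp-anomalous` carried). CONDITIONAL exactly as `GordEvenCongruentPartnerBSD`.

## What and why (r2 §II.30.3 / II.30.8)

Every mod-`5` congruence between curves with irreducible `E[5]` is direct or indirect
(`𝔽₅ˣ/(𝔽₅ˣ)² = {1, 2}`), and `X_E(5)`, `X_E^{(2)}(5)` are both `≅ ℙ¹` over `ℚ` (Rubin–Silverberg /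
Fisher). So a genuine link `E₁[5] ≅ E[5]` MUST show a rational point `(l : m)` on one of the two
families over `j(E₁)` with the right twist `u`, and then `TorsionIso W₁ W 5` is the two identities
`𝔠₄(l,m) = u⁴·c₄(W₁)`, `𝔠₆(l,m) = u⁶·c₆(W₁)` (direct) resp. `4·𝔠₄′(l,m) = 9·u⁴·c₄(W₁)`,
`8·𝔠₆′(l,m) = 27·u⁶·c₆(W₁)` (indirect) — `norm_num` facts per row — through
`Fisher2012.fiveCongruent_of_hesseCertificate hF W W₁ l m u hu h4 h6 : TorsionIso W₁ W 5` (family over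
the RECEIVER `W`, certified member = the PARTNER `W₁`; no `.symm`). r2 GEN 24 found and kernel-checked
such a point for all 18 (receiver member, R-M MATCH partner) pairs of the six e346 classes of record
(`cells/n1011/route2/g24/I1-H5-certs-g24.tsv`; records file = row T-I1-H5).

* `ClassX4Gord.bsdp_rankZero_five_four_of_congruentPartner_mu_zero_of_hesseCertificate_of_shaAn_unit`
  (direct) / `…_of_hesseIndCertificate_…` (indirect) — §A′ of `GordEvenCongruentPartnerBSD` with
  `hT` ↦ {`hF` | `hF'`, the point `(l, m)`, the scaling `u ≠ 0`, the two identities `h4`, `h6`}.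
* `ClassX4Gord.bsdp_rankZero_five_four_of_trivialPartner_of_hesseCertificate_of_shaAn_unit` (direct) /
  `…_of_hesseIndCertificate_…` (indirect) — §B′ likewise: EVERY non-printed binder left is a census
  column (partner `hr₁ htam₁ hL₁ hbsd₁ hna₁`, receiver `hcm hr`, classes), a KERNEL IDENTITY (`h4`,
  `h6`, `hu`), the X4-3 tuple (`h`, `hχ`), the Birch × Pal unit (`hq`, `hu'`), or `ord₅ #Ш_an = 0`.

Direct rows of record (II.30.3): 131100f1 ↔ 300c2 / 50100l1, 233450cr1 ↔ 400925b1, 423150da1 ↔ 10075e1,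
46200dg1 ↔ 600h1 / 472200w1, 499800el1 ↔ 9800bn1; indirect: 131100f1 ↔ 300c1 / 41100o1,
133350bm1 ↔ 5950g1, 46200dg1 ↔ 600h2 / 133800b1 (and the 2-isogenous members da2 / dg2 / el2 flipped).

WHAT IS NEW: nothing mathematically — one-line instantiations; the I1 column of the e346 package at
`p = 5` is now a kernel identity modulo a registered published fact. X4♯(G-ord) stays
CONSTRUCTION-SHAPED; closes nothing; census −0; nothing booked.

References: T. Fisher, Proc. LMS 104 (2012) 613–648, Thm. 13.2 [Fisher2012Hessian]; T. Fisher, Math.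
Ann. 356 (2013) 589–616, Thm. 5.8, Lemma 5.6 [Fisher2013QuinticTwists]; K. Rubin, A. Silverberg,
*Families of elliptic curves with constant mod p representations* (1995); D. Delbourgo, J. Number
Theory 95 (2002) [Delbourgo2002]; D. Delbourgo, Compositio Math. 113 (1998) [Delbourgo1998];
R. Greenberg, V. Vatsal, Invent. Math. 142 (2000) §2 [GreenbergVatsal2000]; cells/n1011/ROUTE-2.md
§II.30.3, II.30.8.
-/

set_option autoImplicit false

noncomputable section

open scoped Classical MatrixGroups ModularForm NumberField

open CongruenceSubgroup WeierstrassCurve NumberField IsDedekindDomain Field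
  Literature.NumberTheory.EllipticCurves
  Literature.NumberTheory.EllipticCurves.ModularForms
  Literature.NumberTheory.EllipticCurves.Rank1Residual
  Literature.NumberTheory.EllipticCurves.Rank1Residual.Typed
  Literature.NumberTheory.EllipticCurves.Delbourgo2002
  Literature.NumberTheory.EllipticCurves.Greenberg1999
  Literature.NumberTheory.EllipticCurves.GreenbergVatsal2000
  Literature.NumberTheory.EllipticCurves.CoatesGreenberg1996
  Literature.NumberTheory.EllipticCurves.Fisher2012

namespace Summit.BirchSwinnertonDyer.Rank1Residual.Additive

open Summit.BirchSwinnertonDyer.Rank1Residual.X1.CongruenceTransfer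

variable {p : ℕ} [hp : Fact p.Prime] {W₁ W : WeierstrassCurve ℚ} [W₁.IsElliptic] [W₁.IsGloballyMinimal]
  [W.IsElliptic] [W.IsGloballyMinimal]

/-! ### §D′ The (5;4,4) ENDs with the link as a Hesse-family kernel identity -/

/-- **T-E346-TP at `(5;4,4)`, opaque partner form, DIRECT Hesse certificate.** §A′ of
`GordEvenCongruentPartnerBSD` with the link `hT : TorsionIso W₁ W 5` replaced by a rational point
`(l : m)` of Fisher's `X_W(5)` over the partner `W₁`: `𝔠₄(l,m) = u⁴·c₄(W₁)`, `𝔠₆(l,m) = u⁶·c₆(W₁)`,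
`u ≠ 0` (`Fisher2012.fiveCongruent_of_hesseCertificate`, modulo the registered fact `hF` = Fisher 2012
Thm. 13.2). Closes nothing by itself; nothing booked.
[cite: Fisher2012Hessian, Thm. 13.2 (n = 5)] [cite: Delbourgo2002, Theorem (A), (C) (p. 40)]
[cite: Delbourgo1998, Prop. 4 (p. 144)]
[cite: GreenbergVatsal2000, §2 Prop. (2.8) with Remark (2.9), Cor. (2.3), pp. 26–27 (arXiv:math/9906215)] -/
theorem ClassX4Gord.bsdp_rankZero_five_four_of_congruentPartner_mu_zero_of_hesseCertificate_of_shaAn_unit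
    (hp5 : p = 5) (hF : thm132_fiveCongruent_hessePencil)
    (hC : Delbourgo2002.thmC_charIdeal_dvd_tameBranch)
    (hDelA : Delbourgo2002.mainTheorem) (hDelM : Delbourgo2002.mainTheorem_potMult)
    (hDel : Delbourgo1998.prop4_rankZero_pow_dvd_constantCoeff)
    (hGZK : rank_eq_analyticRank_of_analyticRank_le_one) (hmod : hasEntireLFunction_rat)
    (hGV : muLambdaAlg_transfer_of_torsionIso_potOrd_of_not_dvd_torsionOrder)
    (hCG : H1_goodModelKernel_trivial.{0})
    (hX : ClassX4Gord W p) (hcm : ¬ W.HasCM) (hr : W.analyticRank = 0)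
    (he : semistabilityIndex W p = 4)
    (hX₁ : ClassX4Gord W₁ p) (hcm₁ : ¬ W₁.HasCM) (he₁ : semistabilityIndex W₁ p = 4)
    -- link certificate: a rational point of X_W(5) over W₁ (kernel identities)
    (l m u : ℚ) (hu : u ≠ 0)
    (h4 : MvPolynomial.eval ![l, m] (hesseC4 W.c₄ W.c₆) = u ^ 4 * W₁.c₄)
    (h6 : MvPolynomial.eval ![l, m] (hesseC6 W.c₄ W.c₆) = u ^ 6 * W₁.c₆)
    (h : CensusX43.OrdinaryTwistPartnerAt W p)
    {N : ℕ} [NeZero N] {f : CuspForm (Gamma0 N) 2} (hf : IsNewformOf W f)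
    {χ : MulChar (ZMod p) ℚ_[p]}
    (hχ : CensusX43.IsTeichmullerPow χ (CensusX43.ordinaryTeichmullerExponent W p))
    (hμ₁ : ∀ (K : ZpExtension ℚ p) (γ : Field.absoluteGaloisGroup ℚ),
      K.IsCyclotomic → K.IsTopGenerator γ → IsCyclotomicVariable p γ →
      ∀ D₁ : W₁.SelmerDualData K γ, D₁.IsTorsion → D₁.mu = 0)
    {q : ℚ} (hq : W.entireLFunction 1 = (q : ℂ) * (W.realPeriodRat : ℂ))
    {u' : ℤ_[p]ˣ} (hu' : ((ratPlusSymbol f 0 : ℚ) : ℚ_[p]) = ((u' : ℤ_[p]) : ℚ_[p]) * (q : ℚ_[p]))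
    {s : ℚ} (hs : shaAn W = (s : ℂ)) (hv : padicValRat p s = 0) : BSDp W p := by
  subst hp5
  exact hX.bsdp_rankZero_five_four_of_congruentPartner_mu_zero_of_shaAn_unit rfl hC hDelA hDelM hDel hGZK
    hmod hGV hCG hcm hr he hX₁ hcm₁ he₁ (fiveCongruent_of_hesseCertificate hF W W₁ l m u hu h4 h6) h hf hχ
    hμ₁ hq hu' hs hv

/-- **T-E346-TP at `(5;4,4)`, opaque partner form, INDIRECT Hesse certificate.** §A′ with `hT`
replaced by a rational point `(l : m)` of Fisher's `X_W^{(2)}(5)` over the partner `W₁`: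
`4·𝔠₄′(l,m) = 9·u⁴·c₄(W₁)`, `8·𝔠₆′(l,m) = 27·u⁶·c₆(W₁)`, `u ≠ 0`
(`Fisher2012.fiveCongruent_of_hesseIndCertificate`, modulo the registered fact `hF'` = Fisher 2013
Thm. 5.8). Closes nothing by itself; nothing booked.
[cite: Fisher2013QuinticTwists, Thm. 5.8 (with Lemma 5.6)] [cite: Delbourgo2002, Theorem (A), (C) (p. 40)]
[cite: Delbourgo1998, Prop. 4 (p. 144)]
[cite: GreenbergVatsal2000, §2 Prop. (2.8) with Remark (2.9), Cor. (2.3), pp. 26–27 (arXiv:math/9906215)] -/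
theorem ClassX4Gord.bsdp_rankZero_five_four_of_congruentPartner_mu_zero_of_hesseIndCertificate_of_shaAn_unit
    (hp5 : p = 5) (hF' : thm58_fiveCongruent_hessePencilInd)
    (hC : Delbourgo2002.thmC_charIdeal_dvd_tameBranch)
    (hDelA : Delbourgo2002.mainTheorem) (hDelM : Delbourgo2002.mainTheorem_potMult)
    (hDel : Delbourgo1998.prop4_rankZero_pow_dvd_constantCoeff)
    (hGZK : rank_eq_analyticRank_of_analyticRank_le_one) (hmod : hasEntireLFunction_rat)
    (hGV : muLambdaAlg_transfer_of_torsionIso_potOrd_of_not_dvd_torsionOrder)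
    (hCG : H1_goodModelKernel_trivial.{0})
    (hX : ClassX4Gord W p) (hcm : ¬ W.HasCM) (hr : W.analyticRank = 0)
    (he : semistabilityIndex W p = 4)
    (hX₁ : ClassX4Gord W₁ p) (hcm₁ : ¬ W₁.HasCM) (he₁ : semistabilityIndex W₁ p = 4)
    -- link certificate: a rational point of X_W^{(2)}(5) over W₁ (kernel identities)
    (l m u : ℚ) (hu : u ≠ 0)
    (h4 : 4 * MvPolynomial.eval ![l, m] (hesseC4ind W.c₄ W.c₆) = 9 * (u ^ 4 * W₁.c₄))
    (h6 : 8 * MvPolynomial.eval ![l, m] (hesseC6ind W.c₄ W.c₆) = 27 * (u ^ 6 * W₁.c₆))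
    (h : CensusX43.OrdinaryTwistPartnerAt W p)
    {N : ℕ} [NeZero N] {f : CuspForm (Gamma0 N) 2} (hf : IsNewformOf W f)
    {χ : MulChar (ZMod p) ℚ_[p]}
    (hχ : CensusX43.IsTeichmullerPow χ (CensusX43.ordinaryTeichmullerExponent W p))
    (hμ₁ : ∀ (K : ZpExtension ℚ p) (γ : Field.absoluteGaloisGroup ℚ),
      K.IsCyclotomic → K.IsTopGenerator γ → IsCyclotomicVariable p γ →
      ∀ D₁ : W₁.SelmerDualData K γ, D₁.IsTorsion → D₁.mu = 0)
    {q : ℚ} (hq : W.entireLFunction 1 = (q : ℂ) * (W.realPeriodRat : ℂ))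
    {u' : ℤ_[p]ˣ} (hu' : ((ratPlusSymbol f 0 : ℚ) : ℚ_[p]) = ((u' : ℤ_[p]) : ℚ_[p]) * (q : ℚ_[p]))
    {s : ℚ} (hs : shaAn W = (s : ℂ)) (hv : padicValRat p s = 0) : BSDp W p := by
  subst hp5
  exact hX.bsdp_rankZero_five_four_of_congruentPartner_mu_zero_of_shaAn_unit rfl hC hDelA hDelM hDel hGZK
    hmod hGV hCG hcm hr he hX₁ hcm₁ he₁ (fiveCongruent_of_hesseIndCertificate hF' W W₁ l m u hu h4 h6) h
    hf hχ hμ₁ hq hu' hs hv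

/-- **T-E346-TP at `(5;4,4)`, trivial-partner form, DIRECT Hesse certificate.** §B′ of
`GordEvenCongruentPartnerBSD` with `hT` replaced by a rational point of `X_W(5)` over the literally
non-anomalous partner `W₁`: every non-printed binder is a census column, a kernel identity, the X4-3
tuple, the Birch × Pal unit, or `ord₅ #Ш_an = 0`. Rows of record: 131100f1 ↔ 300c2 / 50100l1,
233450cr1 ↔ 400925b1, 423150da1 ↔ 10075e1, 46200dg1 ↔ 600h1 / 472200w1. Closes nothing by itself;
nothing booked.
[cite: Fisher2012Hessian, Thm. 13.2 (n = 5)]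
[cite: Delbourgo2002, Theorem (A), (B), (C) (p. 40), case r_E = 0, ℓ_p(E) = 1 (p. 39)]
[cite: Delbourgo1998, Prop. 4 (p. 144)]
[cite: GreenbergVatsal2000, §2 Prop. (2.8) with Remark (2.9), Cor. (2.3), pp. 26–27 (arXiv:math/9906215)] -/
theorem ClassX4Gord.bsdp_rankZero_five_four_of_trivialPartner_of_hesseCertificate_of_shaAn_unit
    (hp5 : p = 5) (hF : thm132_fiveCongruent_hessePencil)
    (hC : Delbourgo2002.thmC_charIdeal_dvd_tameBranch)
    (hDelA : Delbourgo2002.mainTheorem) (hDelM : Delbourgo2002.mainTheorem_potMult)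
    (hDel : Delbourgo1998.prop4_rankZero_pow_dvd_constantCoeff)
    (hGZK : rank_eq_analyticRank_of_analyticRank_le_one) (hmod : hasEntireLFunction_rat)
    (hGV : muLambdaAlg_transfer_of_torsionIso_potOrd_of_not_dvd_torsionOrder)
    (hCG : H1_goodModelKernel_trivial.{0})
    (hX : ClassX4Gord W p) (hcm : ¬ W.HasCM) (hr : W.analyticRank = 0)
    (he : semistabilityIndex W p = 4)
    (hX₁ : ClassX4Gord W₁ p) (hcm₁ : ¬ W₁.HasCM) (he₁ : semistabilityIndex W₁ p = 4)
    (hr₁ : W₁.analyticRank = 0) (htam₁ : ¬ p ∣ W₁.tamagawaProduct)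
    (hL₁ : ∃ q : ℚ, q ≠ 0 ∧ W₁.entireLFunction 1 / (W₁.realPeriodRat : ℂ) = (q : ℂ) ∧
      padicValRat p q = 0)
    (hbsd₁ : BSDp W₁ p) (hna₁ : Delbourgo2002.ReductionNonAnomalous W₁ p)
    -- link certificate: a rational point of X_W(5) over W₁ (kernel identities)
    (l m u : ℚ) (hu : u ≠ 0)
    (h4 : MvPolynomial.eval ![l, m] (hesseC4 W.c₄ W.c₆) = u ^ 4 * W₁.c₄)
    (h6 : MvPolynomial.eval ![l, m] (hesseC6 W.c₄ W.c₆) = u ^ 6 * W₁.c₆)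
    (h : CensusX43.OrdinaryTwistPartnerAt W p)
    {N : ℕ} [NeZero N] {f : CuspForm (Gamma0 N) 2} (hf : IsNewformOf W f)
    {χ : MulChar (ZMod p) ℚ_[p]}
    (hχ : CensusX43.IsTeichmullerPow χ (CensusX43.ordinaryTeichmullerExponent W p))
    {q : ℚ} (hq : W.entireLFunction 1 = (q : ℂ) * (W.realPeriodRat : ℂ))
    {u' : ℤ_[p]ˣ} (hu' : ((ratPlusSymbol f 0 : ℚ) : ℚ_[p]) = ((u' : ℤ_[p]) : ℚ_[p]) * (q : ℚ_[p]))
    {s : ℚ} (hs : shaAn W = (s : ℂ)) (hv : padicValRat p s = 0) : BSDp W p := by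
  subst hp5
  exact hX.bsdp_rankZero_five_four_of_trivialPartner_of_shaAn_unit rfl hC hDelA hDelM hDel hGZK hmod hGV hCG
    hcm hr he hX₁ hcm₁ he₁ hr₁ htam₁ hL₁ hbsd₁ hna₁
    (fiveCongruent_of_hesseCertificate hF W W₁ l m u hu h4 h6) h hf hχ hq hu' hs hv

/-- **T-E346-TP at `(5;4,4)`, trivial-partner form, INDIRECT Hesse certificate.** §B′ with `hT`
replaced by a rational point of `X_W^{(2)}(5)` over the literally non-anomalous partner `W₁`. Rows of
record: 131100f1 ↔ 300c1 / 41100o1, 133350bm1 ↔ 5950g1, 46200dg1 ↔ 600h2 / 133800b1. Closes nothing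
by itself; nothing booked.
[cite: Fisher2013QuinticTwists, Thm. 5.8 (with Lemma 5.6)]
[cite: Delbourgo2002, Theorem (A), (B), (C) (p. 40), case r_E = 0, ℓ_p(E) = 1 (p. 39)]
[cite: Delbourgo1998, Prop. 4 (p. 144)]
[cite: GreenbergVatsal2000, §2 Prop. (2.8) with Remark (2.9), Cor. (2.3), pp. 26–27 (arXiv:math/9906215)] -/
theorem ClassX4Gord.bsdp_rankZero_five_four_of_trivialPartner_of_hesseIndCertificate_of_shaAn_unit
    (hp5 : p = 5) (hF' : thm58_fiveCongruent_hessePencilInd)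
    (hC : Delbourgo2002.thmC_charIdeal_dvd_tameBranch)
    (hDelA : Delbourgo2002.mainTheorem) (hDelM : Delbourgo2002.mainTheorem_potMult)
    (hDel : Delbourgo1998.prop4_rankZero_pow_dvd_constantCoeff)
    (hGZK : rank_eq_analyticRank_of_analyticRank_le_one) (hmod : hasEntireLFunction_rat)
    (hGV : muLambdaAlg_transfer_of_torsionIso_potOrd_of_not_dvd_torsionOrder)
    (hCG : H1_goodModelKernel_trivial.{0})
    (hX : ClassX4Gord W p) (hcm : ¬ W.HasCM) (hr : W.analyticRank = 0)
    (he : semistabilityIndex W p = 4)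
    (hX₁ : ClassX4Gord W₁ p) (hcm₁ : ¬ W₁.HasCM) (he₁ : semistabilityIndex W₁ p = 4)
    (hr₁ : W₁.analyticRank = 0) (htam₁ : ¬ p ∣ W₁.tamagawaProduct)
    (hL₁ : ∃ q : ℚ, q ≠ 0 ∧ W₁.entireLFunction 1 / (W₁.realPeriodRat : ℂ) = (q : ℂ) ∧
      padicValRat p q = 0)
    (hbsd₁ : BSDp W₁ p) (hna₁ : Delbourgo2002.ReductionNonAnomalous W₁ p)
    -- link certificate: a rational point of X_W^{(2)}(5) over W₁ (kernel identities)
    (l m u : ℚ) (hu : u ≠ 0)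
    (h4 : 4 * MvPolynomial.eval ![l, m] (hesseC4ind W.c₄ W.c₆) = 9 * (u ^ 4 * W₁.c₄))
    (h6 : 8 * MvPolynomial.eval ![l, m] (hesseC6ind W.c₄ W.c₆) = 27 * (u ^ 6 * W₁.c₆))
    (h : CensusX43.OrdinaryTwistPartnerAt W p)
    {N : ℕ} [NeZero N] {f : CuspForm (Gamma0 N) 2} (hf : IsNewformOf W f)
    {χ : MulChar (ZMod p) ℚ_[p]}
    (hχ : CensusX43.IsTeichmullerPow χ (CensusX43.ordinaryTeichmullerExponent W p))
    {q : ℚ} (hq : W.entireLFunction 1 = (q : ℂ) * (W.realPeriodRat : ℂ))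
    {u' : ℤ_[p]ˣ} (hu' : ((ratPlusSymbol f 0 : ℚ) : ℚ_[p]) = ((u' : ℤ_[p]) : ℚ_[p]) * (q : ℚ_[p]))
    {s : ℚ} (hs : shaAn W = (s : ℂ)) (hv : padicValRat p s = 0) : BSDp W p := by
  subst hp5
  exact hX.bsdp_rankZero_five_four_of_trivialPartner_of_shaAn_unit rfl hC hDelA hDelM hDel hGZK hmod hGV hCG
    hcm hr he hX₁ hcm₁ he₁ hr₁ htam₁ hL₁ hbsd₁ hna₁
    (fiveCongruent_of_hesseIndCertificate hF' W W₁ l m u hu h4 h6) h hf hχ hq hu' hs hv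

end Summit.BirchSwinnertonDyer.Rank1Residual.Additive

end
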